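import Summits.ValiantsHypothesis.ValiantsHypothesis.Theorems.LangWeilTransferTransferGlue
import Summits.ValiantsHypothesis.ValiantsHypothesis.Theorems.LangWeilTransferLangWeilBound
import Summits.ValiantsHypothesis.ValiantsHypothesis.Theorems.LangWeilTransferScalarRestriction

/-!
# LangWeilTransfer, crux `TameTransfer` (stmt-ValiantsHypothesis-6373) — the typed link

Route `LangWeilTransfer` of `ValiantsHypothesis`. With the supports `LangWeilBound`
(`langWeilBound_proof`, from the tree's Cafure–Matera theorems) and `TransferGlue`
(`transferGlue_proof`) proved, the route's Theorem T — crux `TameTransfer` (GRH-free transfer of a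
tame ℚ-component to a solution over a small `GaloisField p r`) — is reduced to EXACTLY its two
remaining effective-arithmetic supports `GoodReduction` (stmt-6377: effective Noether–Ostrowski over
the geometric factors) and `TameResolution` (stmt-6378: Kronecker/Krick–Pardo parametrisation with
height bounds). This file records that edge as a theorem. It does NOT prove `TameTransfer`: both
hypotheses are open items of the route. Honest framing: bookkeeping inside a dormant route; nothing
here bears on VP ≠ VNP.
-/

-- the summit and the problem share the name `ValiantsHypothesis` (D-0017 single-conjunct layout)
set_option linter.dupNamespace false

namespace Summit.ValiantsHypothesis.ValiantsHypothesis.Theorems.LangWeilTransfer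

open Summit.ValiantsHypothesis.ValiantsHypothesis.Theses.LangWeilTransfer

/-- **Theorem T modulo its two open supports**: `GoodReduction → TameResolution → TameTransfer`
(the landed `transferGlue_proof` fed with the landed `langWeilBound_proof`). -/
theorem tameTransfer_of_goodReduction_of_tameResolution (hGR : GoodReduction)
    (hTR : TameResolution) : TameTransfer :=
  transferGlue_proof langWeilBound_proof hGR hTR

/-- The same edge towards the route's deciding theorem: given the two open cruxes
`ShatteringExclusion`, `SharpPNotPPoly`, the assembly item, and the two open supports
`GoodReduction`, `TameResolution`, the summit follows (`ScalarRestriction`, `LangWeilBound`,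
`TransferGlue` are theorems of the tree). Conditional bookkeeping only. -/
theorem valiantsHypothesis_of_open_items (hSE : ShatteringExclusion) (hGR : GoodReduction)
    (hTR : TameResolution) (hSharpP : SharpPNotPPoly) (hA : Assembly) : _root_.ValiantsHypothesis :=
  closes hSE (tameTransfer_of_goodReduction_of_tameResolution hGR hTR) scalarRestriction_proof
    hSharpP hA

end Summit.ValiantsHypothesis.ValiantsHypothesis.Theorems.LangWeilTransfer
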